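import Literature.Computability.Complexity.OccurrenceObstructionsHookTableaux
import HarnessLib

/-!
# BIP Prop. 7.3 discharged: row-rigid content tableaux of the hook-like shapes for every block
width of the printed window (Bürgisser–Ikenmeyer–Panova 2019, §7)

Topic `Literature/Computability/Complexity`, conventions of `OccurrenceObstructionsBIP.lean`,
`OccurrenceObstructionsHooks.lean` and `OccurrenceObstructionsHookTableaux.lean` (hook-like shapes
`hookPartition b c i D = b × 1 + c × i + 1 × (D - b - ci)` with rows `hookRows`; "λ occurs" in the
weight form `highestWeightSpace (coordRep (MatIdx N) ℂ n) (partitionWeightLex N λ)`; content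
tableaux `CplxAlg.ContentTableau.*`, the row-rigidity criterion `CplxAlg.fst_perm_eq_fst` = BIP
Claim 7.1 in abstract form, and the pipeline `CplxAlg.exists_wreathInvariant_hwv` "row-rigid
labelling of `μ ⊢ D m` by `D` letters with classes of size `m` ⇒ `a_μ(D[m]) > 0`").

Source: P. Bürgisser, C. Ikenmeyer, G. Panova, *No occurrence obstructions in geometric complexity
theory*, J. AMS 32 (2019) 163–193 = arXiv:1604.06431v3, §7: (7.1), Claim 7.1, Props. 7.2, 7.3 and
their proofs (flat numbering Claim 35, Propositions 36, 37 of the held arXiv text, pp. 21–23).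

The named fact `bip2019_prop_7_3` (`OccurrenceObstructionsHooks.lean`) is the printed Prop. 7.3:
"Let `t, r` be positive integers, `i ∈ [(r+2t)²/(2t), (r+2t)²/(2t) + r + t + 1]`, and let `n > 6t +
2r` and `d > r + 2t + i`. Let `ν = (t+1) × i + (r+1) × 1 + (j)`, where `j = dn - (r+1) - (t+1)i`.
Then `a_ν(d[n]) > 0`." This file PROVES it (`bip2019_prop_7_3_holds`), by the printed method — an
explicit tableau `T` of shape `ν` with content `d × n` and the row tensor, all respecting bijections
of nonzero value having the value `1` — for EVERY integer `i` of the window. The tree's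
`OccurrenceObstructionsHookTableaux.lean` does this for one specific even `i` per `(t, r)` (enough
for Thm. 6.2); here the block width is arbitrary in the window, which needs a more flexible tableau.

The printed proof of Prop. 7.3 has two gaps, both repaired here without touching the statement.
(a) In BIP's subtableau `T'` ("let the label `s` appear in `T'` exactly `s` times") the label `s = 1`
has a single cell below the first row; exchanging it with the first-row cell above it (and the
singleton cells of the two labels) is a respecting bijection of value `-1`, so "all nonzero
summands have the value 1" fails for the printed `T` (remark already recorded in
`TableauPositivity.lean`). (b) For `i` above the row length `i'` of `T'` the print says "the tableau
construction below can be modified by increasing the number of appearances of the `t` largest labels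
by `i - i' ≤ r + t`"; but `i - i' ≤ r + t` is false in general, and putting the whole defect on one
label per row can exceed the `n` cells a label has (e.g. `t = 1`, `r = 2`, `i = 12`, `n = 11`: `i' =
3`, and the enlarged first-column label `te = 2` would need `te + 1 + (i - i') = 12 > n` cells). The
corrected tableau (§3 below) shifts all multiplicities by a constant `c ≥ 1` chosen maximal (so that
the remaining defect is `< 2E = e`), and drops the label of multiplicity one when `c = 1`.

Contents.

* §1 `designQ`, `designOff`, `designP`, `designCell` — the cell map of the content tableau attached
  to an arbitrary *block design*: `K` block labels `u < K`, label `u` owning `mul u` consecutive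
  cells of the block row `row u` (rows of the `t × i` block, `0`-based) and, for `u < r`, the
  hanging first-column cell `(u+1, 0)` (BIP's first-column labels); the next `i + 1` labels own one
  first-row cell each; all remaining cells are singleton cells of the first row, dealt out in order
  — verbatim the layout of `hookCell` (`OccurrenceObstructionsHookTableaux.lean`) with `hookMul t`,
  `u % t`, `hookK t E`, `hookI t E` replaced by `mul`, `row`, `K`, `i`.
* §2 the design hypotheses (block rows summing to `i`, sizes `mul u + [u < r]` pairwise distinct,
  `≥ 2`, `≤ n`, `row u = u` for `u < min(r,t)`, `r ≤ K`, `K + i + 1 ≤ d`) make the cell map a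
  bijection `[0,d) × [0,n) → cells of (r+1) × 1 + (t+1) × i + 1 × j ⊢ d n` (`designCell_mem`,
  `designCell_injective`, `exists_designLabelling`) whose labelling satisfies (S0), (S1), (S3),
  (S4) of `CplxAlg.fst_perm_eq_fst` (`rowRigid_designLabelling`), whence
  `exists_wreathInvariant_hwv_of_design` (word model) and `exists_hwv_hookPartition_of_design`
  (weight form) — the proofs of HookTableaux §2–§4, generalised.
* §3 `p73E`, `p73T`, `p73C`, `p73D`, `p73K`, `p73Mul`, `p73Row` — the block design for Prop. 7.3:
  BIP's `T'` (zigzag rows "`min(ℓ, 2t-ℓ+1)`, `s ≡ ℓ (mod 2t)`", `e = 2(⌊(r-1)/2t⌋ + 1)` layers so that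
  `r ≤ T = te ≤ r + 2t - 1`, first-column labels the `r` largest) with multiplicities `c + (T-1-u)`,
  `c = ⌊(⌊i/E⌋ + 1 - T)/2⌋ ≥ 1` maximal with row sum `E(T + 2c - 1) ≤ i` (`E = e/2`), the defect `δ =
  i - E(T + 2c - 1) < 2E` added to the `t` largest labels `u < t` (one per block row), and for `c =
  1 < T - r + 1` the label `T - 1` (multiplicity one) dropped, its cell given to the label `0` of the
  same row. Labels are indexed by decreasing multiplicity, so the sizes `mul u + [u < r]` are
  strictly decreasing.
* §4 the arithmetic: `r ≤ K ≤ T ≤ r + 2t - 1` (`p73T_bounds`, `le_p73K`, `p73K_add_le`), `c ≥ 1`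
  (`one_le_p73C`, from `(T+1)² ≤ (r+2t)² ≤ 2ti`), `δ < 2E` (`p73D_lt`), sizes strictly decreasing
  (`p73Q_injOn`), `≥ 2` (`two_le_p73Q`), `≤ c + T + δ + 1 ≤ 6t + 2r + 1` (`p73_size_bound`, via the
  polynomial inequality `p73_poly_ineq`), and every block row summing to `E(T + 2c - 1) + δ = i`
  (`sum_filter_p73Row`, `sum_pairs_base`, `p73_rowsum`).
* §5 `bip2019_prop_7_3_holds`. No reduction to small `n, d` (Lemma 4.5, (5.3) of the print) is
  needed: surplus labels and letters are absorbed by singleton cells. The design covers the printed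
  cases `r < t` (Prop. 7.2) and `r ≥ t` uniformly.

No statement of the tree is changed; with `bip2019_prop_7_3_holds` the conditional assemblies
`bip2019_thm_6_2_of_prop_7_3`, `bip2019_no_occurrence_obstructions_of_prop_7_3`,
`no_occurrence_obstructions_succ_of_prop_7_3` (`OccurrenceObstructionsHooks.lean`,
`PlethysmStabilityBIP.lean`) lose their Prop. 7.3 hypothesis.

## References

* P. Bürgisser, C. Ikenmeyer, G. Panova, *No occurrence obstructions in geometric complexity
  theory*, J. AMS 32 (2019) = arXiv:1604.06431v3: §4 Thm. 4.7; §7 (7.1), Claim 7.1, Props. 7.2,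
  7.3 (statements and proofs). [key `BurgisserIkenmeyerPanovaJAMS2019`]

## Mathlib and tree

Mathlib: `Finset.sum` over `range`/`filter` (`sum_filter`, `sum_fiberwise_of_maps_to`,
`sum_eq_single_of_mem`, `sum_ite_eq'`, `filter_insert`, `range_add_one`, `sum_range_succ`),
`Finset.card_image_of_injOn`, `Fintype.bijective_iff_injective_and_card`, `Equiv.ofBijective`,
`Nat.div_add_mod`, `Nat.lt_mul_div_succ`, `Nat.le_div_iff_mul_le`, `nlinarith`. Tree:
`hookPartition`/`hookRows` (`antitone_hookRows`, `sum_range_hookRows`, `card_parts_partitionOfRows_le`),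
`hookRows_succ_succ`, `mem_youngDiagram_hookPartition`, `rowLen_youngDiagram_hookPartition`,
`sum_range_layers` (`OccurrenceObstructionsHookTableaux.lean`), `CplxAlg.ContentTableau.*`,
`CplxAlg.fst_perm_eq_fst`, `CplxAlg.exists_wreathInvariant_hwv` (`TableauPositivity.lean`),
`CplxAlg.formOfWord` (`formOfWord_mem_highestWeightSpace`, `formOfWord_ne_zero`,
`isHomogeneous_formOfWord`), `revMatIdx` (`strictAnti_revMatIdx`, `neg_partitionWeightLex_revMatIdx`),
`Nat.Partition.card_cells_youngDiagram`. New definitions: only the cell-map bookkeeping of §1 and the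
design parameters of §3.
-/

open scoped BigOperators

namespace Literature.Computability.Complexity

open Finset

/-! ### 1. The cell map of a block design -/

section Design

variable {r K i n : ℕ} {row mul : ℕ → ℕ}

/-- The number of *structured* (non-singleton) cells of the label `u` in the content tableau of a
block design with `K` block labels of multiplicities `mul` and block width `i`: a block label `u < K`
has its `mul u` block cells and, if `u < r`, the hanging cell `(u + 1, 0)` of the first column; the
next `i + 1` labels `K ≤ u ≤ K + i` own one cell each (the first-row cells of the non-singleton
columns); all further labels have singleton cells only (cf. `hookQ`).
[cite: BurgisserIkenmeyerPanovaJAMS2019, Prop. 7.3 (proof)] -/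
def designQ (r K i : ℕ) (mul : ℕ → ℕ) (u : ℕ) : ℕ :=
  if u < K then mul u + (if u < r then 1 else 0) else if u ≤ K + i then 1 else 0

/-- The column offset of the block label `u` inside its block row `row u`: the block cells of the
earlier labels of the same row come first (cf. `hookOff`).
[cite: BurgisserIkenmeyerPanovaJAMS2019, Prop. 7.3 (proof)] -/
def designOff (row mul : ℕ → ℕ) (u : ℕ) : ℕ :=
  ∑ v ∈ (range u).filter (fun v => row v = row u), mul v

/-- Prefix sums of the numbers `n - designQ v` of singleton cells of the labels `v < u` (the
singleton cells of the first row are dealt out to the labels in order; cf. `hookP`).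
[cite: BurgisserIkenmeyerPanovaJAMS2019, Prop. 7.3 (proof)] -/
def designP (r K i n : ℕ) (mul : ℕ → ℕ) (u : ℕ) : ℕ := ∑ v ∈ range u, (n - designQ r K i mul v)

/-- **The content tableau of a block design, as a cell map.** `designCell r K i n row mul u ν` is the
cell carrying the `ν`-th copy of the label `u`: for `ν < designQ u` a structured cell — for a block
label `u < K` its block cells `(row u + 1, δ + designOff u + ν)` (`δ = 1` in the rows `≤ r`, which
start with a first-column cell) followed, if `u < r`, by the hanging first-column cell `(u + 1, 0)`;
for `K ≤ u ≤ K + i` the first-row cell `(0, u - K)` — and for `ν ≥ designQ u` the singleton cell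
`(0, i + 1 + designP u + (ν - designQ u))` of the first row (cf. `hookCell`, the case `mul = hookMul t`,
`row u = u % t`, `K = hookK t E`, `i = hookI t E`). [cite: BurgisserIkenmeyerPanovaJAMS2019, Prop. 7.3 (proof)] -/
def designCell (r K i n : ℕ) (row mul : ℕ → ℕ) (u ν : ℕ) : ℕ × ℕ :=
  if ν < designQ r K i mul u then
    (if u < K then
      (if ν < mul u then (row u + 1, (if row u < r then 1 else 0) + designOff row mul u + ν)
        else (u + 1, 0))
      else (0, u - K))
  else (0, i + 1 + designP r K i n mul u + (ν - designQ r K i mul u))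

/-- Structured cells of a block label. [cite: BurgisserIkenmeyerPanovaJAMS2019, Prop. 7.3 (proof)] -/
theorem designQ_of_lt {u : ℕ} (hu : u < K) :
    designQ r K i mul u = mul u + (if u < r then 1 else 0) := by
  unfold designQ; rw [if_pos hu]

/-- Structured cells of a first-row label. [cite: BurgisserIkenmeyerPanovaJAMS2019, Prop. 7.3 (proof)] -/
theorem designQ_of_ge_of_le {u : ℕ} (hu : K ≤ u) (hu' : u ≤ K + i) : designQ r K i mul u = 1 := by
  unfold designQ; rw [if_neg (not_lt.mpr hu), if_pos hu']

/-- The filler labels have no structured cell. [cite: BurgisserIkenmeyerPanovaJAMS2019, Prop. 7.3 (proof)] -/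
theorem designQ_of_gt {u : ℕ} (hu : K + i < u) : designQ r K i mul u = 0 := by
  unfold designQ; rw [if_neg (by omega), if_neg (by omega)]

/-- The block cells are structured cells. [cite: BurgisserIkenmeyerPanovaJAMS2019, Prop. 7.3 (proof)] -/
theorem le_designQ_of_lt {u : ℕ} (hu : u < K) : mul u ≤ designQ r K i mul u := by
  rw [designQ_of_lt hu]; exact Nat.le_add_right _ _

/-- A block label has at most one hanging cell. [cite: BurgisserIkenmeyerPanovaJAMS2019, Prop. 7.3 (proof)] -/
theorem designQ_le_add_one {u : ℕ} (hu : u < K) : designQ r K i mul u ≤ mul u + 1 := by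
  rw [designQ_of_lt hu]; split_ifs <;> omega

/-- The block labels `u < r` have a hanging cell. [cite: BurgisserIkenmeyerPanovaJAMS2019, Prop. 7.3 (proof)] -/
theorem designQ_eq_add_one {u : ℕ} (hu : u < K) (hur : u < r) : designQ r K i mul u = mul u + 1 := by
  rw [designQ_of_lt hu, if_pos hur]

/-- The block labels `u ≥ r` have no hanging cell. [cite: BurgisserIkenmeyerPanovaJAMS2019, Prop. 7.3 (proof)] -/
theorem designQ_eq_of_le {u : ℕ} (hu : u < K) (hur : r ≤ u) : designQ r K i mul u = mul u := by
  rw [designQ_of_lt hu, if_neg (not_lt.mpr hur), add_zero]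

/-- A non-block label has at most one structured cell (BIP Claim 7.1: `|C_u^1| > n - 2` for `u > D`).
[cite: BurgisserIkenmeyerPanovaJAMS2019, Claim 7.1] -/
theorem designQ_le_one {u : ℕ} (hu : K ≤ u) : designQ r K i mul u ≤ 1 := by
  unfold designQ; rw [if_neg (not_lt.mpr hu)]; split_ifs <;> omega

/-- Only the labels `u ≤ K + i` have structured cells. [cite: BurgisserIkenmeyerPanovaJAMS2019, Prop. 7.3 (proof)] -/
theorem le_of_designQ_pos {u : ℕ} (h : 0 < designQ r K i mul u) : u ≤ K + i := by
  by_contra hgt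
  rw [designQ_of_gt (not_le.mp hgt)] at h
  exact lt_irrefl 0 h

/-- Recursion of the prefix sums of singleton cells. [folklore] -/
theorem designP_succ (u : ℕ) :
    designP r K i n mul (u + 1) = designP r K i n mul u + (n - designQ r K i mul u) := by
  unfold designP; rw [sum_range_succ]

/-- The prefix sums of singleton cells are monotone. [folklore] -/
theorem designP_mono {u v : ℕ} (h : u ≤ v) : designP r K i n mul u ≤ designP r K i n mul v := by
  unfold designP
  exact Finset.sum_le_sum_of_subset (range_subset_range.mpr h)

/-- Consecutive blocks of singleton cells are disjoint. [folklore] -/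
theorem designP_succ_le {u v : ℕ} (h : u < v) :
    designP r K i n mul u + (n - designQ r K i mul u) ≤ designP r K i n mul v := by
  rw [← designP_succ]; exact designP_mono h

/-- Offset plus multiplicity is the next prefix sum of the row. [cite: BurgisserIkenmeyerPanovaJAMS2019, Prop. 7.3 (proof)] -/
theorem designOff_add_eq (u : ℕ) : designOff row mul u + mul u =
    ∑ v ∈ (range (u + 1)).filter (fun v => row v = row u), mul v := by
  rw [designOff, Finset.range_add_one, Finset.filter_insert, if_pos rfl,
    Finset.sum_insert (by simp), add_comm]

/-- In a block row, the cells of an earlier label come before those of a later label of the same row.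
[cite: BurgisserIkenmeyerPanovaJAMS2019, Prop. 7.3 (proof)] -/
theorem designOff_add_le_designOff {u u' : ℕ} (hrow : row u = row u') (hlt : u < u') :
    designOff row mul u + mul u ≤ designOff row mul u' := by
  rw [designOff_add_eq, designOff, hrow]
  exact Finset.sum_le_sum_of_subset
    (Finset.filter_subset_filter _ (range_subset_range.mpr (Nat.succ_le_of_lt hlt)))

/-- The block cells of a block label. [cite: BurgisserIkenmeyerPanovaJAMS2019, Prop. 7.3 (proof)] -/
theorem designCell_block {u ν : ℕ} (hQ : ν < designQ r K i mul u) (hu : u < K) (hν : ν < mul u) :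
    designCell r K i n row mul u ν = (row u + 1, (if row u < r then 1 else 0) + designOff row mul u + ν) := by
  unfold designCell; rw [if_pos hQ, if_pos hu, if_pos hν]

/-- The hanging cell of a block label. [cite: BurgisserIkenmeyerPanovaJAMS2019, Prop. 7.3 (proof)] -/
theorem designCell_hanging {u ν : ℕ} (hQ : ν < designQ r K i mul u) (hu : u < K) (hν : ¬ ν < mul u) :
    designCell r K i n row mul u ν = (u + 1, 0) := by
  unfold designCell; rw [if_pos hQ, if_pos hu, if_neg hν]

/-- Only the block labels `u < r` hang. [cite: BurgisserIkenmeyerPanovaJAMS2019, Prop. 7.3 (proof)] -/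
theorem lt_of_designCell_hanging {u ν : ℕ} (hQ : ν < designQ r K i mul u) (hu : u < K) (hν : ¬ ν < mul u) : u < r := by
  by_contra h
  rw [designQ_eq_of_le hu (not_lt.mp h)] at hQ
  exact hν hQ

/-- The first-row structured cell of a first-row label. [cite: BurgisserIkenmeyerPanovaJAMS2019, Prop. 7.3 (proof)] -/
theorem designCell_rowZero {u ν : ℕ} (hQ : ν < designQ r K i mul u) (hu : ¬ u < K) :
    designCell r K i n row mul u ν = (0, u - K) := by
  unfold designCell; rw [if_pos hQ, if_neg hu]

/-- The singleton cells. [cite: BurgisserIkenmeyerPanovaJAMS2019, Prop. 7.3 (proof)] -/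
theorem designCell_singleton {u ν : ℕ} (hQ : ¬ ν < designQ r K i mul u) :
    designCell r K i n row mul u ν = (0, i + 1 + designP r K i n mul u + (ν - designQ r K i mul u)) := by
  unfold designCell; rw [if_neg hQ]

/-- **The cells below the first row are exactly the structured cells of the block labels.**
[cite: BurgisserIkenmeyerPanovaJAMS2019, Claim 7.1 and Prop. 7.3 (proof)] -/
theorem fst_designCell_ne_zero_iff {u ν : ℕ} :
    (designCell r K i n row mul u ν).1 ≠ 0 ↔ ν < designQ r K i mul u ∧ u < K := by
  constructor
  · intro h
    by_cases hQ : ν < designQ r K i mul u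
    · by_cases hu : u < K
      · exact ⟨hQ, hu⟩
      · rw [designCell_rowZero hQ hu] at h; exact absurd rfl h
    · rw [designCell_singleton hQ] at h; exact absurd rfl h
  · rintro ⟨hQ, hu⟩
    by_cases hν : ν < mul u
    · rw [designCell_block hQ hu hν]; exact Nat.succ_ne_zero _
    · rw [designCell_hanging hQ hu hν]; exact Nat.succ_ne_zero _

end Design

end Literature.Computability.Complexity

namespace Literature.Computability.Complexity

open Finset AlgebraicComplexity AlgebraicComplexity.ContentTableau

/-! ### 2. From a block design to a row-rigid content tableau

#### 2a. Counting: structured cells and singleton cells -/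

section Counting

variable {t r K i n d : ℕ} {row mul : ℕ → ℕ}

/-- The block labels fill the `t × i` block exactly: `∑_{u < K} mul u = t · i` when every block row
sums to `i`. [cite: BurgisserIkenmeyerPanovaJAMS2019, Prop. 7.3 (proof)] -/
theorem sum_mul_eq_of_rows (hrow : ∀ u, u < K → row u < t)
    (hsum : ∀ j, j < t → ∑ u ∈ (range K).filter (fun u => row u = j), mul u = i) :
    ∑ u ∈ range K, mul u = t * i := by
  rw [← Finset.sum_fiberwise_of_maps_to (s := range K) (t := range t) (g := row)
    (fun u hu => mem_range.mpr (hrow u (mem_range.mp hu))) mul]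
  rw [Finset.sum_congr rfl fun j hj => hsum j (mem_range.mp hj), sum_const, card_range, smul_eq_mul]

/-- **The structured cells are the body of the shape and the non-singleton part of the first row**:
`∑_{u < d} designQ u = t i + r + (i + 1)` when `r ≤ K` and `K + i + 1 ≤ d`.
[cite: BurgisserIkenmeyerPanovaJAMS2019, Prop. 7.3 (proof)] -/
theorem sum_designQ (hrK : r ≤ K) (hrow : ∀ u, u < K → row u < t)
    (hsum : ∀ j, j < t → ∑ u ∈ (range K).filter (fun u => row u = j), mul u = i)
    (hd : K + i + 1 ≤ d) :
    ∑ u ∈ range d, designQ r K i mul u = t * i + r + (i + 1) := by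
  obtain ⟨d', rfl⟩ := Nat.exists_eq_add_of_le hd
  rw [show K + i + 1 + d' = K + (i + 1 + d') by ring, sum_range_add]
  have h1 : ∑ u ∈ range K, designQ r K i mul u = t * i + r := by
    have hc : ∀ u ∈ range K, designQ r K i mul u = mul u + (if u < r then 1 else 0) :=
      fun u hu => designQ_of_lt (mem_range.mp hu)
    rw [Finset.sum_congr rfl hc, sum_add_distrib, sum_mul_eq_of_rows hrow hsum, Finset.sum_boole, Nat.cast_id]
    congr 1
    rw [show (range K).filter (fun u => u < r) = range r from by
      ext u; simp only [mem_filter, mem_range]; omega]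
    exact card_range r
  have h2 : ∑ x ∈ range (i + 1 + d'), designQ r K i mul (K + x) = i + 1 := by
    have hz : ∀ x ∈ range d', designQ r K i mul (K + (i + 1 + x)) = 0 :=
      fun x _ => designQ_of_gt (by omega)
    have ho : ∀ x ∈ range (i + 1), designQ r K i mul (K + x) = 1 :=
      fun x hx => designQ_of_ge_of_le (Nat.le_add_right _ _) (by have := mem_range.mp hx; omega)
    rw [sum_range_add, Finset.sum_eq_zero hz, add_zero, Finset.sum_congr rfl ho, sum_const, card_range,
      smul_eq_mul, mul_one]
  rw [h1, h2]

/-- Every label has at most `n` structured cells, provided the block labels do and `n ≥ 1`.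
[cite: BurgisserIkenmeyerPanovaJAMS2019, Prop. 7.3 (proof)] -/
theorem designQ_le (hQn : ∀ u, u < K → mul u + (if u < r then 1 else 0) ≤ n) (hn : 1 ≤ n) (u : ℕ) :
    designQ r K i mul u ≤ n := by
  by_cases hu : u < K
  · rw [designQ_of_lt hu]; exact hQn u hu
  · exact (designQ_le_one (not_lt.mp hu)).trans hn

/-- **The count of singleton cells**: the singleton cells and the structured cells together are the
`d n` cells of the shape (`designP d = d n - (t i + r + i + 1)` = the number of singleton columns of
the first row). [cite: BurgisserIkenmeyerPanovaJAMS2019, Prop. 7.3 (proof)] -/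
theorem designP_eq (hrK : r ≤ K) (hrow : ∀ u, u < K → row u < t)
    (hsum : ∀ j, j < t → ∑ u ∈ (range K).filter (fun u => row u = j), mul u = i)
    (hd : K + i + 1 ≤ d) (hQn : ∀ u, u < K → mul u + (if u < r then 1 else 0) ≤ n) (hn : 1 ≤ n) :
    designP r K i n mul d + (t * i + r + (i + 1)) = d * n := by
  have hc : ∀ u ∈ range d, (n - designQ r K i mul u) + designQ r K i mul u = n :=
    fun u _ => Nat.sub_add_cancel (designQ_le hQn hn u)
  rw [← sum_designQ hrK hrow hsum hd, designP, ← sum_add_distrib, Finset.sum_congr rfl hc, sum_const,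
    card_range, smul_eq_mul]

/-- The block cells of a block label fit into its row of length `i`.
[cite: BurgisserIkenmeyerPanovaJAMS2019, Prop. 7.3 (proof)] -/
theorem designOff_add_le (hrow : ∀ u, u < K → row u < t)
    (hsum : ∀ j, j < t → ∑ u ∈ (range K).filter (fun u => row u = j), mul u = i) {u : ℕ} (hu : u < K) :
    designOff row mul u + mul u ≤ i := by
  rw [designOff_add_eq, ← hsum (row u) (hrow u hu)]
  exact Finset.sum_le_sum_of_subset
    (Finset.filter_subset_filter _ (range_subset_range.mpr (Nat.succ_le_of_lt hu)))

end Counting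

/-! #### 2b. The cell map lands in the shape and is injective -/

section Cells

variable {t r K i n d : ℕ} {row mul : ℕ → ℕ}
  (ht : 0 < t) (hr₀ : 0 < r) (hrK : r ≤ K) (hrow : ∀ u, u < K → row u < t)
  (hsum : ∀ j, j < t → ∑ u ∈ (range K).filter (fun u => row u = j), mul u = i)
  (hQn : ∀ u, u < K → mul u + (if u < r then 1 else 0) ≤ n) (hn : 1 ≤ n) (hd : K + i + 1 ≤ d)
include hrK hrow hsum hQn hn hd

/-- The parameters of a block design make `(r+1) × 1 + (t+1) × i + 1 × j ⊢ d n` a genuine hook-like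
shape: `(r + 1) + (t + 1) i ≤ d n`. [cite: BurgisserIkenmeyerPanovaJAMS2019, Prop. 7.3 (proof)] -/
theorem designShape_le : r + 1 + (t + 1) * i ≤ d * n := by
  have := designP_eq hrK hrow hsum hd hQn hn
  nlinarith

/-- **The cell map lands in the shape** (`u < d`, `ν < n`): block cells fit into their rows
(`designOff_add_le`), hanging cells into the first column (`u < r`), first-row cells into the first
row (`designP_eq`). [cite: BurgisserIkenmeyerPanovaJAMS2019, Prop. 7.3 (proof)] -/
theorem designCell_mem {u ν : ℕ} (hu : u < d) (hν : ν < n) :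
    designCell r K i n row mul u ν ∈ (hookPartition (r + 1) (t + 1) i (d * n)).youngDiagram := by
  have hP := designP_eq hrK hrow hsum hd hQn hn
  have hsh := designShape_le hrK hrow hsum hQn hn hd
  have key0 : ∀ y : ℕ, (0, y) ∈ (hookPartition (r + 1) (t + 1) i (d * n)).youngDiagram ↔
      y < d * n - r - t * i := fun y => by
    rw [mem_youngDiagram_hookPartition (Nat.succ_pos r) (Nat.succ_pos t) hsh, hookRows_succ_succ, if_pos rfl]
  have keyS : ∀ a y : ℕ, (a + 1, y) ∈ (hookPartition (r + 1) (t + 1) i (d * n)).youngDiagram ↔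
      y < (if a < r then 1 else 0) + (if a < t then i else 0) := fun a y => by
    rw [mem_youngDiagram_hookPartition (Nat.succ_pos r) (Nat.succ_pos t) hsh, hookRows_succ_succ,
      if_neg (Nat.succ_ne_zero a)]
    simp only [Nat.add_one_le_iff]
  by_cases h1 : ν < designQ r K i mul u
  · by_cases h2 : u < K
    · by_cases h3 : ν < mul u
      · rw [designCell_block h1 h2 h3, keyS, if_pos (hrow u h2)]
        have hoff := designOff_add_le hrow hsum h2
        by_cases h4 : row u < r
        · rw [if_pos h4]; omega
        · rw [if_neg h4]; omega
      · rw [designCell_hanging h1 h2 h3, keyS, if_pos (lt_of_designCell_hanging h1 h2 h3)]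
        omega
    · rw [designCell_rowZero h1 h2, key0]
      have := le_of_designQ_pos (lt_of_le_of_lt (Nat.zero_le ν) h1)
      omega
  · rw [designCell_singleton h1, key0]
    have := designP_succ_le (r := r) (K := K) (i := i) (n := n) (mul := mul) hu
    omega

omit hrK hrow hsum hQn hn hd in
/-- **The cell map is injective** on `ν, ν' < n`: different regions are separated by the row (`0` or
not) and the column (`0`, `≤ i`, `> i`); inside a block row different labels occupy disjoint column
intervals (`designOff_add_le_designOff`), and the singleton cells of different labels disjoint
intervals (`designP_succ_le`). [cite: BurgisserIkenmeyerPanovaJAMS2019, Prop. 7.3 (proof)] -/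
theorem designCell_injective {u ν u' ν' : ℕ} (hν : ν < n) (hν' : ν' < n)
    (h : designCell r K i n row mul u ν = designCell r K i n row mul u' ν') : u = u' ∧ ν = ν' := by
  by_cases h1 : ν < designQ r K i mul u <;> by_cases h1' : ν' < designQ r K i mul u'
  · -- structured / structured
    by_cases h2 : u < K <;> by_cases h2' : u' < K
    · by_cases h3 : ν < mul u <;> by_cases h3' : ν' < mul u'
      · -- block / block
        rw [designCell_block h1 h2 h3, designCell_block h1' h2' h3', Prod.mk.injEq] at h
        obtain ⟨hrw, hcol⟩ := h
        have hrw' : row u = row u' := by omega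
        rw [hrw'] at hcol
        rcases lt_trichotomy u u' with hlt | rfl | hgt
        · have := designOff_add_le_designOff (mul := mul) hrw' hlt; omega
        · exact ⟨rfl, by omega⟩
        · have := designOff_add_le_designOff (mul := mul) hrw'.symm hgt; omega
      · -- block / hanging
        exfalso
        rw [designCell_block h1 h2 h3, designCell_hanging h1' h2' h3', Prod.mk.injEq] at h
        obtain ⟨hrw, hcol⟩ := h
        have h4 : u' < r := lt_of_designCell_hanging h1' h2' h3'
        have : row u < r := by omega
        rw [if_pos this] at hcol
        omega
      · exfalso
        rw [designCell_hanging h1 h2 h3, designCell_block h1' h2' h3', Prod.mk.injEq] at h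
        obtain ⟨hrw, hcol⟩ := h
        have h4 : u < r := lt_of_designCell_hanging h1 h2 h3
        have : row u' < r := by omega
        rw [if_pos this] at hcol
        omega
      · -- hanging / hanging
        rw [designCell_hanging h1 h2 h3, designCell_hanging h1' h2' h3', Prod.mk.injEq] at h
        have hu : u = u' := by omega
        subst hu
        have := designQ_le_add_one (r := r) (i := i) (mul := mul) h2
        exact ⟨rfl, by omega⟩
    · exfalso
      rw [designCell_rowZero h1' h2'] at h
      by_cases h3 : ν < mul u
      · rw [designCell_block h1 h2 h3, Prod.mk.injEq] at h; omega
      · rw [designCell_hanging h1 h2 h3, Prod.mk.injEq] at h; omega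
    · exfalso
      rw [designCell_rowZero h1 h2] at h
      by_cases h3' : ν' < mul u'
      · rw [designCell_block h1' h2' h3', Prod.mk.injEq] at h; omega
      · rw [designCell_hanging h1' h2' h3', Prod.mk.injEq] at h; omega
    · rw [designCell_rowZero h1 h2, designCell_rowZero h1' h2', Prod.mk.injEq] at h
      have hq := designQ_le_one (r := r) (i := i) (mul := mul) (not_lt.mp h2)
      have hq' := designQ_le_one (r := r) (i := i) (mul := mul) (not_lt.mp h2')
      exact ⟨by omega, by omega⟩
  · exfalso
    rw [designCell_singleton h1'] at h
    by_cases h2 : u < K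
    · by_cases h3 : ν < mul u
      · rw [designCell_block h1 h2 h3, Prod.mk.injEq] at h; omega
      · rw [designCell_hanging h1 h2 h3, Prod.mk.injEq] at h; omega
    · rw [designCell_rowZero h1 h2, Prod.mk.injEq] at h
      have := le_of_designQ_pos (lt_of_le_of_lt (Nat.zero_le ν) h1)
      omega
  · exfalso
    rw [designCell_singleton h1] at h
    by_cases h2 : u' < K
    · by_cases h3 : ν' < mul u'
      · rw [designCell_block h1' h2 h3, Prod.mk.injEq] at h; omega
      · rw [designCell_hanging h1' h2 h3, Prod.mk.injEq] at h; omega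
    · rw [designCell_rowZero h1' h2, Prod.mk.injEq] at h
      have := le_of_designQ_pos (lt_of_le_of_lt (Nat.zero_le ν') h1')
      omega
  · -- singleton / singleton
    rw [designCell_singleton h1, designCell_singleton h1', Prod.mk.injEq] at h
    rcases lt_trichotomy u u' with hlt | rfl | hgt
    · have := designP_succ_le (r := r) (K := K) (i := i) (n := n) (mul := mul) hlt; omega
    · exact ⟨rfl, by omega⟩
    · have := designP_succ_le (r := r) (K := K) (i := i) (n := n) (mul := mul) hgt; omega

omit hrK hQn hn hd in
/-- **The structured cells are exactly the cells of the non-singleton columns `≤ i`.**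
[cite: BurgisserIkenmeyerPanovaJAMS2019, Prop. 7.3 (proof)] -/
theorem snd_designCell_lt_iff {u ν : ℕ} :
    (designCell r K i n row mul u ν).2 < i + 1 ↔ ν < designQ r K i mul u := by
  constructor
  · intro h
    by_contra hQ
    rw [designCell_singleton hQ] at h
    simp only at h
    omega
  · intro hQ
    by_cases hu : u < K
    · by_cases hν : ν < mul u
      · rw [designCell_block hQ hu hν]
        have := designOff_add_le hrow hsum hu
        split_ifs <;> simp only <;> omega
      · rw [designCell_hanging hQ hu hν]; simp only; omega
    · rw [designCell_rowZero hQ hu]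
      have := le_of_designQ_pos (lt_of_le_of_lt (Nat.zero_le ν) hQ)
      simp only; omega

end Cells

/-! #### 2c. The labelling of the cells and its row rigidity -/

section Labelling

variable {t r K i n d : ℕ} {row mul : ℕ → ℕ}
  (ht : 0 < t) (hr₀ : 0 < r) (hrK : r ≤ K) (hrow : ∀ u, u < K → row u < t)
  (hrow' : ∀ u, u < r → u < t → row u = u)
  (hsum : ∀ j, j < t → ∑ u ∈ (range K).filter (fun u => row u = j), mul u = i)
  (hinj : ∀ u v, u < K → v < K →
    mul u + (if u < r then 1 else 0) = mul v + (if v < r then 1 else 0) → u = v)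
  (htwo : ∀ u, u < K → 2 ≤ mul u + (if u < r then 1 else 0))
  (hQn : ∀ u, u < K → mul u + (if u < r then 1 else 0) ≤ n) (hn : 1 ≤ n) (hd : K + i + 1 ≤ d)
include ht hr₀ hrK hrow hsum hQn hn hd

omit ht hr₀ in
/-- **The content tableau of a block design as a labelling of the cells.** The cell map is a
bijection from `[0,d) × [0,n)` onto the cells of the shape (injective between sets of the same size
`d n`), so its inverse followed by the first projection labels the cells of
`(r+1) × 1 + (t+1) × i + 1 × j ⊢ d n` by `Fin d`, the label `u` sitting exactly on the cells
`designCell u ν`, `ν < n`. [cite: BurgisserIkenmeyerPanovaJAMS2019, Prop. 7.3 (proof)] -/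
theorem exists_designLabelling : ∃ L : ℕ × ℕ → Fin d,
    (∀ (u : Fin d) (ν : ℕ), ν < n → L (designCell r K i n row mul u ν) = u) ∧
    (∀ c ∈ (hookPartition (r + 1) (t + 1) i (d * n)).youngDiagram.cells,
      ∃ ν < n, c = designCell r K i n row mul (L c) ν) := by
  classical
  set Y := (hookPartition (r + 1) (t + 1) i (d * n)).youngDiagram with hY
  have hdpos : 0 < d := by omega
  set Φ : Fin d × Fin n → Y.cells := fun p =>
    ⟨designCell r K i n row mul p.1 p.2,
      (YoungDiagram.mem_cells _).2 (designCell_mem hrK hrow hsum hQn hn hd p.1.2 p.2.2)⟩ with hΦ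
  have hinjΦ : Function.Injective Φ := by
    rintro ⟨u, ν⟩ ⟨u', ν'⟩ h
    have h' : designCell r K i n row mul u ν = designCell r K i n row mul u' ν' := congrArg Subtype.val h
    obtain ⟨h1, h2⟩ := designCell_injective ν.2 ν'.2 h'
    exact Prod.ext (Fin.ext h1) (Fin.ext h2)
  have hbij : Function.Bijective Φ := by
    rw [Fintype.bijective_iff_injective_and_card]
    refine ⟨hinjΦ, ?_⟩
    rw [Fintype.card_prod, Fintype.card_fin, Fintype.card_fin, Fintype.card_coe,
      Nat.Partition.card_cells_youngDiagram]
  set e := Equiv.ofBijective Φ hbij with he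
  refine ⟨fun c => if h : c ∈ Y.cells then (e.symm ⟨c, h⟩).1 else ⟨0, hdpos⟩, ?_, ?_⟩
  · intro u ν hν
    have hmem : designCell r K i n row mul u ν ∈ Y.cells :=
      (YoungDiagram.mem_cells _).2 (designCell_mem hrK hrow hsum hQn hn hd u.2 hν)
    simp only [dif_pos hmem]
    have : e.symm ⟨designCell r K i n row mul u ν, hmem⟩ = (u, ⟨ν, hν⟩) := by
      rw [Equiv.symm_apply_eq]; rfl
    rw [this]
  · intro c hc
    simp only [dif_pos hc]
    refine ⟨(e.symm ⟨c, hc⟩).2, (e.symm ⟨c, hc⟩).2.2, ?_⟩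
    have h1 : e (e.symm ⟨c, hc⟩) = ⟨c, hc⟩ := e.apply_symm_apply _
    exact (congrArg Subtype.val h1).symm

variable {L : ℕ × ℕ → Fin d}
  (hL₁ : ∀ (u : Fin d) (ν : ℕ), ν < n → L (designCell r K i n row mul u ν) = u)
  (hL₂ : ∀ c ∈ (hookPartition (r + 1) (t + 1) i (d * n)).youngDiagram.cells,
      ∃ ν < n, c = designCell r K i n row mul (L c) ν)
include hL₁ hL₂

omit ht hr₀ in
/-- The class `C_u` of the label `u` is the set of cells `designCell u ν`, `ν < n`.
[cite: BurgisserIkenmeyerPanovaJAMS2019, Prop. 7.3 (proof)] -/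
theorem cellsOf_designLabelling (u : Fin d) :
    cellsOf (hookPartition (r + 1) (t + 1) i (d * n)).youngDiagram L u =
      (range n).image (designCell r K i n row mul u) := by
  ext c
  simp only [cellsOf, mem_filter, mem_image, mem_range, YoungDiagram.mem_cells]
  constructor
  · rintro ⟨hc, rfl⟩
    obtain ⟨ν, hν, hcν⟩ := hL₂ c ((YoungDiagram.mem_cells _).2 hc)
    exact ⟨ν, hν, hcν.symm⟩
  · rintro ⟨ν, hν, rfl⟩
    exact ⟨designCell_mem hrK hrow hsum hQn hn hd u.2 hν, hL₁ u ν hν⟩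

omit ht hr₀ in
/-- **Content `d × n`**: every class has exactly `n` cells. [cite: BurgisserIkenmeyerPanovaJAMS2019, Prop. 7.3 (proof)] -/
theorem card_cellsOf_designLabelling (u : Fin d) :
    (cellsOf (hookPartition (r + 1) (t + 1) i (d * n)).youngDiagram L u).card = n := by
  rw [cellsOf_designLabelling hrK hrow hsum hQn hn hd hL₁ hL₂, card_image_of_injOn, card_range]
  intro ν hν ν' hν' h
  exact (designCell_injective (mem_range.mp hν) (mem_range.mp hν') h).2

/-- The cells of `C_u` in the non-singleton columns are the structured cells `designCell u ν`,
`ν < designQ u`. [cite: BurgisserIkenmeyerPanovaJAMS2019, Prop. 7.3 (proof)] -/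
theorem nonsingletonCellsOf_designLabelling (u : Fin d) :
    nonsingletonCellsOf (hookPartition (r + 1) (t + 1) i (d * n)).youngDiagram L u =
      (range (designQ r K i mul u)).image (designCell r K i n row mul u) := by
  have hrw : (hookPartition (r + 1) (t + 1) i (d * n)).youngDiagram.rowLen 1 = i + 1 := by
    rw [rowLen_youngDiagram_hookPartition (Nat.succ_pos r) (Nat.succ_pos t)
      (designShape_le hrK hrow hsum hQn hn hd), hookRows_succ_succ, if_neg Nat.one_ne_zero]
    have : 1 ≤ r := by omega
    split_ifs <;> omega
  ext c
  simp only [nonsingletonCellsOf, mem_filter, mem_image, mem_range, YoungDiagram.mem_cells, hrw]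
  constructor
  · rintro ⟨hc, rfl, hcol⟩
    obtain ⟨ν, hν, hcν⟩ := hL₂ c ((YoungDiagram.mem_cells _).2 hc)
    refine ⟨ν, ?_, hcν.symm⟩
    rw [hcν] at hcol
    exact (snd_designCell_lt_iff hrow hsum).mp hcol
  · rintro ⟨ν, hν, rfl⟩
    have hνn : ν < n := lt_of_lt_of_le hν (designQ_le hQn hn _)
    exact ⟨designCell_mem hrK hrow hsum hQn hn hd u.2 hνn, hL₁ u ν hνn,
      (snd_designCell_lt_iff hrow hsum).mpr hν⟩

/-- `|C_u ∖ C_u^1| = designQ u`. [cite: BurgisserIkenmeyerPanovaJAMS2019, Prop. 7.3 (proof)] -/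
theorem card_nonsingletonCellsOf_designLabelling (u : Fin d) :
    (nonsingletonCellsOf (hookPartition (r + 1) (t + 1) i (d * n)).youngDiagram L u).card =
      designQ r K i mul u := by
  rw [nonsingletonCellsOf_designLabelling ht hr₀ hrK hrow hsum hQn hn hd hL₁ hL₂, card_image_of_injOn, card_range]
  intro ν hν ν' hν' h
  have hQ := designQ_le (r := r) (K := K) (i := i) hQn hn (u : ℕ)
  exact (designCell_injective (lt_of_lt_of_le (mem_range.mp hν) hQ)
    (lt_of_lt_of_le (mem_range.mp hν') hQ) h).2

/-- `|C_u^1| = n - designQ u` (BIP: `|C_u^1| = n - β(u)`). [cite: BurgisserIkenmeyerPanovaJAMS2019, Prop. 7.3 (proof)] -/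
theorem card_singletonCellsOf_designLabelling (u : Fin d) :
    (singletonCellsOf (hookPartition (r + 1) (t + 1) i (d * n)).youngDiagram L u).card =
      n - designQ r K i mul u := by
  have h := card_nonsingletonCellsOf_add_card_singletonCellsOf
    (Y := (hookPartition (r + 1) (t + 1) i (d * n)).youngDiagram) (lab := L) u
  rw [card_cellsOf_designLabelling hrK hrow hsum hQn hn hd hL₁ hL₂,
    card_nonsingletonCellsOf_designLabelling ht hr₀ hrK hrow hsum hQn hn hd hL₁ hL₂] at h
  omega

omit ht hr₀ in
include htwo in
/-- The labels with a cell below the first row are exactly the block labels `u < K` (BIP's `u ≤ D`).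
[cite: BurgisserIkenmeyerPanovaJAMS2019, Claim 7.1 and Prop. 7.3 (proof)] -/
theorem hasLowCell_designLabelling_iff (u : Fin d) :
    HasLowCell (hookPartition (r + 1) (t + 1) i (d * n)).youngDiagram L u ↔ (u : ℕ) < K := by
  constructor
  · rintro ⟨c, hc, rfl, hc1⟩
    obtain ⟨ν, hν, hcν⟩ := hL₂ c hc
    rw [hcν] at hc1
    exact (fst_designCell_ne_zero_iff.mp hc1).2
  · intro hu
    have hQ : 0 < designQ r K i mul u := by
      rw [designQ_of_lt hu]; exact lt_of_lt_of_le (by norm_num) (htwo u hu)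
    have hn0 : 0 < n := hn
    refine ⟨designCell r K i n row mul u 0,
      (YoungDiagram.mem_cells _).2 (designCell_mem hrK hrow hsum hQn hn hd u.2 hn0),
      hL₁ u 0 hn0, fst_designCell_ne_zero_iff.mpr ⟨hQ, hu⟩⟩

include hrow' hinj htwo in
/-- **Row rigidity of the content tableau of a block design**: every class-preserving, weakly
column-regular permutation of the cells preserves rows — the hypotheses (S0), (S1), (S3), (S4) of
the abstract Claim 7.1 (`CplxAlg.fst_perm_eq_fst`) hold: non-block labels have at most one
structured cell (`designQ_le_one`), block labels at least two, all below the first row, block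
labels are separated by `|C_u^1|` (the sizes `mul u + [u < r]` are pairwise distinct), and the
structured cells of a block label lie in its block row `row u + 1` and, if it hangs below the block
(`t ≤ u < r`), in the row `u + 1`, whose only cell is in the first column while the block cells of
the rows `≤ r` are not. This is BIP's "all nonzero summands in (4.3) have the value 1".
[cite: BurgisserIkenmeyerPanovaJAMS2019, Claim 7.1 and Props. 7.2, 7.3 (proofs)] -/
theorem rowRigid_designLabelling
    (τ' : Equiv.Perm (hookPartition (r + 1) (t + 1) i (d * n)).youngDiagram.cells)
    (hcls : ∀ c c' : (hookPartition (r + 1) (t + 1) i (d * n)).youngDiagram.cells,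
      L (τ' c) = L (τ' c') ↔ L c = L c')
    (hCR : ∀ c : (hookPartition (r + 1) (t + 1) i (d * n)).youngDiagram.cells,
      (((τ' c : (hookPartition (r + 1) (t + 1) i (d * n)).youngDiagram.cells) : ℕ × ℕ).1,
        (c : ℕ × ℕ).2) ∈ (hookPartition (r + 1) (t + 1) i (d * n)).youngDiagram) :
    ∀ c : (hookPartition (r + 1) (t + 1) i (d * n)).youngDiagram.cells,
      ((τ' c : (hookPartition (r + 1) (t + 1) i (d * n)).youngDiagram.cells) : ℕ × ℕ).1 =
        (c : ℕ × ℕ).1 := by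
  have hns := nonsingletonCellsOf_designLabelling ht hr₀ hrK hrow hsum hQn hn hd hL₁ hL₂
  have hlow := hasLowCell_designLabelling_iff hrK hrow hsum htwo hQn hn hd hL₁ hL₂
  refine fst_perm_eq_fst (n := n) ?_ ?_ ?_ ?_ ?_ τ' hcls hCR
  · intro c _
    exact card_cellsOf_designLabelling hrK hrow hsum hQn hn hd hL₁ hL₂ (L c)
  · intro u hu
    rw [card_nonsingletonCellsOf_designLabelling ht hr₀ hrK hrow hsum hQn hn hd hL₁ hL₂]
    exact designQ_le_one (not_lt.mp ((not_congr (hlow u)).mp hu))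
  · intro u hu
    have hu' := (hlow u).mp hu
    refine ⟨fun c hc => ?_, ?_⟩
    · rw [hns, mem_image] at hc
      obtain ⟨ν, hν, rfl⟩ := hc
      exact fst_designCell_ne_zero_iff.mpr ⟨mem_range.mp hν, hu'⟩
    · rw [card_nonsingletonCellsOf_designLabelling ht hr₀ hrK hrow hsum hQn hn hd hL₁ hL₂, designQ_of_lt hu']
      exact htwo u hu'
  · intro u v hu hv h
    rw [card_singletonCellsOf_designLabelling ht hr₀ hrK hrow hsum hQn hn hd hL₁ hL₂,
      card_singletonCellsOf_designLabelling ht hr₀ hrK hrow hsum hQn hn hd hL₁ hL₂] at h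
    have hu' := (hlow u).mp hu
    have hv' := (hlow v).mp hv
    have hQu := designQ_le (r := r) (K := K) (i := i) hQn hn (u : ℕ)
    have hQv := designQ_le (r := r) (K := K) (i := i) hQn hn (v : ℕ)
    have hQeq : designQ r K i mul u = designQ r K i mul v := by omega
    rw [designQ_of_lt hu', designQ_of_lt hv'] at hQeq
    exact Fin.ext (hinj u v hu' hv' hQeq)
  · intro u hu
    have hu' := (hlow u).mp hu
    refine ⟨row u + 1, if (u : ℕ) < r then (u : ℕ) + 1 else row u + 1, ?_, ?_, ?_⟩
    · split_ifs with hur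
      · refine Nat.succ_le_succ ?_
        by_cases hut : (u : ℕ) < t
        · exact (hrow' u hur hut).le
        · exact (hrow u hu').le.trans (not_lt.mp hut)
      · exact le_rfl
    · intro c hc
      rw [hns, mem_image] at hc
      obtain ⟨ν, hν, rfl⟩ := hc
      rw [mem_range] at hν
      by_cases hνx : ν < mul u
      · left; rw [designCell_block hν hu' hνx]
      · right
        rw [designCell_hanging hν hu' hνx, if_pos (lt_of_designCell_hanging hν hu' hνx)]
    · intro hab c hc hca
      rw [hns, mem_image] at hc
      obtain ⟨ν, hν, rfl⟩ := hc
      rw [mem_range] at hν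
      have hur : (u : ℕ) < r := by
        by_contra hur; rw [if_neg hur] at hab; exact lt_irrefl _ hab
      rw [if_pos hur] at hab ⊢
      have hνx : ν < mul u := by
        by_contra hνx
        rw [designCell_hanging hν hu' hνx] at hca
        simp only at hca
        omega
      have hut : ¬ (u : ℕ) < t := fun hut => by
        have := hrow' u hur hut
        omega
      rw [designCell_block hν hu' hνx, if_pos (lt_of_lt_of_le (hrow u hu') (le_trans (not_lt.mp hut) hur.le))]
      simp only
      rw [mem_youngDiagram_hookPartition (Nat.succ_pos r) (Nat.succ_pos t)
        (designShape_le hrK hrow hsum hQn hn hd), hookRows_succ_succ, if_neg (Nat.succ_ne_zero _)]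
      rw [if_neg (by omega : ¬ (u : ℕ) + 1 ≤ t)]
      split_ifs <;> omega

end Labelling

/-! #### 2d. Positivity of the plethysm coefficient from a block design -/

section Positivity

variable {t r K i n d : ℕ} {row mul : ℕ → ℕ}

/-- **`a_ν(d[n]) > 0` for the hook-like shapes from a block design, word model**: for `t, r ≥ 1` and a
block design (`K ≥ r` block labels with block rows `row u < t`, `row u = u` for `u < min(r,t)`,
every block row filled exactly, sizes `mul u + [u < r]` pairwise distinct, `≥ 2` and `≤ n`, and `d
≥ K + i + 1` labels) there is a nonzero `S_d ≀ S_n`-invariant highest-weight vector of weight `ν =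
(r+1) × 1 + (t+1) × i + 1 × j ⊢ d n` in `(k^N)^{⊗ d n}` for every alphabet with at least `max r t +
1 = ℓ(ν)` letters — the tableau vector of the row-rigid content tableau
(`CplxAlg.exists_wreathInvariant_hwv`, the method of BIP §7 with Thm. 4.7).
[cite: BurgisserIkenmeyerPanovaJAMS2019, §7 (Claim 7.1, Props. 7.2, 7.3) and Thm. 4.7] -/
theorem exists_wreathInvariant_hwv_of_design {k : Type*} [Field k] [CharZero k] {N : ℕ} (ht : 0 < t)
    (hr₀ : 0 < r) (hrK : r ≤ K) (hrow : ∀ u, u < K → row u < t)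
    (hrow' : ∀ u, u < r → u < t → row u = u)
    (hsum : ∀ j, j < t → ∑ u ∈ (range K).filter (fun u => row u = j), mul u = i)
    (hinj : ∀ u v, u < K → v < K →
      mul u + (if u < r then 1 else 0) = mul v + (if v < r then 1 else 0) → u = v)
    (htwo : ∀ u, u < K → 2 ≤ mul u + (if u < r then 1 else 0))
    (hQn : ∀ u, u < K → mul u + (if u < r then 1 else 0) ≤ n) (hd : K + i + 1 ≤ d)
    (hN : max r t + 1 ≤ N) :
    ∃ x : Literature.NumberTheory.DiophantineGeometry.Word N (d * n) → k,
      x ∈ Literature.NumberTheory.DiophantineGeometry.highestWeightSpace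
        (Literature.NumberTheory.DiophantineGeometry.wordRep k N (d * n))
        (Literature.NumberTheory.DiophantineGeometry.Weight.ofPartition N (hookPartition (r + 1) (t + 1) i (d * n))) ∧
      x ≠ 0 ∧ ∀ τ ∈ AlgebraicComplexity.blockPerms d n, Literature.NumberTheory.DiophantineGeometry.wordPerm k τ x = x := by
  have hn : 1 ≤ n := le_trans (by norm_num) ((htwo 0 (lt_of_lt_of_le hr₀ hrK)).trans (hQn 0 (lt_of_lt_of_le hr₀ hrK)))
  obtain ⟨L, hL₁, hL₂⟩ := exists_designLabelling hrK hrow hsum hQn hn hd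
  have hsh := designShape_le hrK hrow hsum hQn hn hd
  refine AlgebraicComplexity.exists_wreathInvariant_hwv _ ?_ L ?_ ?_
  · calc (hookPartition (r + 1) (t + 1) i (d * n)).parts.card ≤ max (r + 1) (t + 1) :=
          card_parts_partitionOfRows_le (antitone_hookRows (Nat.succ_pos r) (Nat.succ_pos t) hsh)
            (sum_range_hookRows (Nat.succ_pos r) (Nat.succ_pos t) hsh)
      _ ≤ N := by omega
  · intro u
    exact card_cellsOf_designLabelling hrK hrow hsum hQn hn hd hL₁ hL₂ u
  · exact rowRigid_designLabelling ht hr₀ hrK hrow hrow' hsum hinj htwo hQn hn hd hL₁ hL₂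

/-- **Positivity of the plethysm coefficients of the hook-like shapes from a block design, in the
weight form of the topic** (the format of the named fact `bip2019_prop_7_3` of
`OccurrenceObstructionsHooks.lean`, with `V = ℂ^{N×N}`, `N² ≥ max r t + 1`): there is a NONZERO form
of degree `d` on `Sym^n V^*` in the highest-weight space of weight `ν^*`,
`ν = hookPartition (r+1) (t+1) i (d n)` — the wreath-invariant vector read back through
`CplxAlg.formOfWord` (as in `exists_hwv_hookPartition`). [cite: BurgisserIkenmeyerPanovaJAMS2019, §7 (Props. 7.2, 7.3)] -/
theorem exists_hwv_hookPartition_of_design (N : ℕ) (ht : 0 < t) (hr₀ : 0 < r) (hrK : r ≤ K)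
    (hrow : ∀ u, u < K → row u < t) (hrow' : ∀ u, u < r → u < t → row u = u)
    (hsum : ∀ j, j < t → ∑ u ∈ (range K).filter (fun u => row u = j), mul u = i)
    (hinj : ∀ u v, u < K → v < K →
      mul u + (if u < r then 1 else 0) = mul v + (if v < r then 1 else 0) → u = v)
    (htwo : ∀ u, u < K → 2 ≤ mul u + (if u < r then 1 else 0))
    (hQn : ∀ u, u < K → mul u + (if u < r then 1 else 0) ≤ n) (hd : K + i + 1 ≤ d)
    (hN : max r t + 1 ≤ N * N) :
    ∃ h : MvPolynomial (AlgebraicComplexity.DegIdx (Literature.NumberTheory.DiophantineGeometry.MatIdx N) n) ℂ,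
      h ≠ 0 ∧ h.IsHomogeneous d ∧
      h ∈ Literature.NumberTheory.DiophantineGeometry.highestWeightSpace
        (AlgebraicComplexity.coordRep (Literature.NumberTheory.DiophantineGeometry.MatIdx N) ℂ n)
        (partitionWeightLex N (hookPartition (r + 1) (t + 1) i (d * n))) := by
  obtain ⟨x, hxw, hx0, hxinv⟩ :=
    exists_wreathInvariant_hwv_of_design (k := ℂ) (N := N * N) ht hr₀ hrK hrow hrow' hsum hinj htwo hQn hd hN
  refine ⟨AlgebraicComplexity.formOfWord (revMatIdx N) n d x, AlgebraicComplexity.formOfWord_ne_zero _ hxinv hx0,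
    AlgebraicComplexity.isHomogeneous_formOfWord _ x,
    AlgebraicComplexity.formOfWord_mem_highestWeightSpace (strictAnti_revMatIdx N) hxinv ?_⟩
  have : (fun j => -(partitionWeightLex N (hookPartition (r + 1) (t + 1) i (d * n))) (revMatIdx N j)) =
      Literature.NumberTheory.DiophantineGeometry.Weight.ofPartition (N * N) (hookPartition (r + 1) (t + 1) i (d * n)) :=
    funext (neg_partitionWeightLex_revMatIdx N _)
  rw [this]
  exact hxw

end Positivity

end Literature.Computability.Complexity

/-! ### 3. The block design of BIP Prop. 7.3 (corrected) -/

namespace Literature.Computability.Complexity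

open Finset

section P73

/-- `E = ⌊(r-1)/2t⌋ + 1`, the number of PAIRS of layers (BIP: "`e := 2(⌊(r-1)/(2t)⌋ + 1)`, so that
`r ≤ te ≤ r + 2t - 1` and `e` is even"; `E = e/2`). [cite: BurgisserIkenmeyerPanovaJAMS2019, Prop. 7.3 (proof)] -/
def p73E (t r : ℕ) : ℕ := (r - 1) / (2 * t) + 1

/-- `T = te = 2tE`, the number of slots of the subtableau `T'` (`t` block rows times `e` layers);
`r ≤ T ≤ r + 2t - 1`. [cite: BurgisserIkenmeyerPanovaJAMS2019, Prop. 7.3 (proof)] -/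
def p73T (t r : ℕ) : ℕ := 2 * t * p73E t r

/-- The shift `c ≥ 1` of the multiplicities: the largest `c` with `E(T + 2c - 1) ≤ i` (the row sum
of the multiplicities `c, c+1, …, c+T-1` in zigzag position is `E(T + 2c - 1)`; BIP's `T'` is
`c = 1`, row sum `i' = (te+1)e/2`). [cite: BurgisserIkenmeyerPanovaJAMS2019, Prop. 7.3 (proof)] -/
def p73C (t r i : ℕ) : ℕ := (i / p73E t r + 1 - p73T t r) / 2

/-- The defect `δ = i - E(T + 2c - 1) ∈ [0, 2E)`, added to the multiplicity of the largest label of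
every block row (BIP: "the tableau construction … can be modified by increasing the number of
appearances of the `t` largest labels by `i - i'`"). [cite: BurgisserIkenmeyerPanovaJAMS2019, Prop. 7.3 (proof)] -/
def p73D (t r i : ℕ) : ℕ := i - p73E t r * (p73T t r + 2 * p73C t r i - 1)

/-- The number `K` of block labels: all `T` slots, except that for `c = 1 < T - r + 1` the label of
multiplicity one is dropped (`K = T - 1 ≥ r`). [cite: BurgisserIkenmeyerPanovaJAMS2019, Prop. 7.3 (proof)] -/
def p73K (t r i : ℕ) : ℕ := if p73C t r i = 1 ∧ r < p73T t r then p73T t r - 1 else p73T t r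

/-- The multiplicity (number of block cells) of the block label `u < K`: `c + (T - 1 - u)`
(decreasing in `u`, so that the hanging labels `u < r` — BIP's first-column labels `te, …, te-r+1`
— are the `r` largest), plus the defect `δ` for the `t` largest labels `u < t` (one in each block
row), plus the cell of the dropped label for `u = 0` when `c = 1 < T - r + 1`.
[cite: BurgisserIkenmeyerPanovaJAMS2019, Prop. 7.3 (proof)] -/
def p73Mul (t r i u : ℕ) : ℕ :=
  p73C t r i + (p73T t r - 1 - u) + (if u < t then p73D t r i else 0) +
    (if p73C t r i = 1 ∧ r < p73T t r ∧ u = 0 then 1 else 0)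

/-- The block row of the label `u` (zigzag by layers of `t`: the identity on even layers, reversed on
odd layers — BIP: "let the label `s` appear … only in row `min(ℓ, 2t-ℓ+1)`, where `s ≡ ℓ (mod 2t)`",
`0`-based and read from the largest label), which makes the `t` row sums of `c + (T - 1 - u)` equal.
[cite: BurgisserIkenmeyerPanovaJAMS2019, Prop. 7.3 (proof)] -/
def p73Row (t u : ℕ) : ℕ := if u / t % 2 = 0 then u % t else t - 1 - u % t

variable {t r i : ℕ}

/-- Unfolding of `p73K` in the dropping case. [cite: BurgisserIkenmeyerPanovaJAMS2019, Prop. 7.3 (proof)] -/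
theorem p73K_of_drop (h : p73C t r i = 1 ∧ r < p73T t r) : p73K t r i = p73T t r - 1 := by
  unfold p73K; rw [if_pos h]

/-- Unfolding of `p73K` in the non-dropping case. [cite: BurgisserIkenmeyerPanovaJAMS2019, Prop. 7.3 (proof)] -/
theorem p73K_of_not_drop (h : ¬ (p73C t r i = 1 ∧ r < p73T t r)) : p73K t r i = p73T t r := by
  unfold p73K; rw [if_neg h]

/-- The block rows are rows of the block: `p73Row t u < t`. [cite: BurgisserIkenmeyerPanovaJAMS2019, Prop. 7.3 (proof)] -/
theorem p73Row_lt (ht : 0 < t) (u : ℕ) : p73Row t u < t := by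
  unfold p73Row; have := Nat.mod_lt u ht; split_ifs <;> omega

/-- The `t` largest labels sit in their own rows: `p73Row t u = u` for `u < t` (so that the hanging
cell `(u+1, 0)` of such a label lies in its block row). [cite: BurgisserIkenmeyerPanovaJAMS2019, Prop. 7.3 (proof)] -/
theorem p73Row_of_lt {u : ℕ} (hu : u < t) : p73Row t u = u := by
  unfold p73Row; rw [Nat.div_eq_of_lt hu, Nat.zero_mod, if_pos rfl, Nat.mod_eq_of_lt hu]

/-- The zigzag row of the slot `q t + j` of layer `q`: `j` on even layers, `t - 1 - j` on odd
layers. [cite: BurgisserIkenmeyerPanovaJAMS2019, Prop. 7.3 (proof)] -/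
theorem p73Row_layer (ht : 0 < t) (q : ℕ) {j : ℕ} (hj : j < t) :
    p73Row t (q * t + j) = if q % 2 = 0 then j else t - 1 - j := by
  have hdiv : (q * t + j) / t = q := by
    rw [Nat.add_comm, Nat.add_mul_div_right _ _ ht, Nat.div_eq_of_lt hj, Nat.zero_add]
  have hmod : (q * t + j) % t = j := by
    rw [Nat.add_comm, Nat.add_mul_mod_self_right, Nat.mod_eq_of_lt hj]
  unfold p73Row; rw [hdiv, hmod]

/-- On an even layer `2a` the zigzag row of the slot `2at + j` is `j`. [cite: BurgisserIkenmeyerPanovaJAMS2019, Prop. 7.3 (proof)] -/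
theorem p73Row_even (ht : 0 < t) (a : ℕ) {j : ℕ} (hj : j < t) : p73Row t (2 * a * t + j) = j := by
  have hdiv : (2 * a * t + j) / t = 2 * a := by
    rw [Nat.add_comm, Nat.add_mul_div_right _ _ ht, Nat.div_eq_of_lt hj, Nat.zero_add]
  have hmod : (2 * a * t + j) % t = j := by
    rw [Nat.add_comm, Nat.add_mul_mod_self_right, Nat.mod_eq_of_lt hj]
  unfold p73Row; rw [hdiv, hmod, if_pos (by omega)]

/-- On an odd layer `2a+1` the zigzag row of the slot `(2a+1)t + j` is `t - 1 - j`. [cite: BurgisserIkenmeyerPanovaJAMS2019, Prop. 7.3 (proof)] -/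
theorem p73Row_odd (ht : 0 < t) (a : ℕ) {j : ℕ} (hj : j < t) : p73Row t ((2 * a + 1) * t + j) = t - 1 - j := by
  have hdiv : ((2 * a + 1) * t + j) / t = 2 * a + 1 := by
    rw [Nat.add_comm, Nat.add_mul_div_right _ _ ht, Nat.div_eq_of_lt hj, Nat.zero_add]
  have hmod : ((2 * a + 1) * t + j) % t = j := by
    rw [Nat.add_comm, Nat.add_mul_mod_self_right, Nat.mod_eq_of_lt hj]
  unfold p73Row; rw [hdiv, hmod, if_neg (by omega)]

end P73

end Literature.Computability.Complexity

namespace Literature.Computability.Complexity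

open Finset

/-! ### 4. The arithmetic of the design

#### 4a. The parameters `E, T, c, δ, K` -/

section P73Arith

variable {t r i : ℕ}

/-- `r ≤ T ≤ r + 2t - 1` (BIP: "so that `r ≤ te ≤ r + 2t - 1`"). [cite: BurgisserIkenmeyerPanovaJAMS2019, Prop. 7.3 (proof)] -/
theorem p73T_bounds (ht : 0 < t) (hr : 0 < r) : r ≤ p73T t r ∧ p73T t r + 1 ≤ r + 2 * t := by
  unfold p73T p73E
  have h1 := Nat.div_add_mod (r - 1) (2 * t)
  have h2 := Nat.mod_lt (r - 1) (show 0 < 2 * t by omega)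
  rw [Nat.mul_add, Nat.mul_one]
  omega

/-- `E ≥ 1`. [cite: BurgisserIkenmeyerPanovaJAMS2019, Prop. 7.3 (proof)] -/
theorem p73E_pos : 0 < p73E t r := Nat.succ_pos _

/-- `T ≥ 2t`: there are at least two layers. [cite: BurgisserIkenmeyerPanovaJAMS2019, Prop. 7.3 (proof)] -/
theorem two_mul_le_p73T : 2 * t ≤ p73T t r := by
  unfold p73T; exact Nat.le_mul_of_pos_right _ p73E_pos

/-- **The window starts above the `c = 1` row sum**: `E(T + 2) ≤ i` whenever `(r+2t)² ≤ 2ti` (from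
`(T+1)² ≤ (r+2t)²` and `(T+1)² = 2t·E(T+2) + 1`). [cite: BurgisserIkenmeyerPanovaJAMS2019, Prop. 7.3 (proof)] -/
theorem p73E_mul_le (ht : 0 < t) (hr : 0 < r) (hi₁ : (r + 2 * t) ^ 2 ≤ 2 * t * i) :
    p73E t r * (p73T t r + 2) ≤ i := by
  obtain ⟨-, hTr⟩ := p73T_bounds (t := t) ht hr
  have h1 : (p73T t r + 1) ^ 2 ≤ (r + 2 * t) ^ 2 := Nat.pow_le_pow_left hTr 2
  have h2 : (p73T t r + 1) ^ 2 = 2 * t * (p73E t r * (p73T t r + 2)) + 1 := by unfold p73T; ring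
  have h3 : 2 * t * (p73E t r * (p73T t r + 2)) < 2 * t * i := by omega
  exact (Nat.lt_of_mul_lt_mul_left h3).le

/-- `T + 2 ≤ ⌊i/E⌋`. [cite: BurgisserIkenmeyerPanovaJAMS2019, Prop. 7.3 (proof)] -/
theorem p73T_add_two_le_div (ht : 0 < t) (hr : 0 < r) (hi₁ : (r + 2 * t) ^ 2 ≤ 2 * t * i) :
    p73T t r + 2 ≤ i / p73E t r :=
  (Nat.le_div_iff_mul_le p73E_pos).mpr (by rw [Nat.mul_comm]; exact p73E_mul_le ht hr hi₁)

/-- **The shift is positive**: `c ≥ 1`. [cite: BurgisserIkenmeyerPanovaJAMS2019, Prop. 7.3 (proof)] -/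
theorem one_le_p73C (ht : 0 < t) (hr : 0 < r) (hi₁ : (r + 2 * t) ^ 2 ≤ 2 * t * i) : 1 ≤ p73C t r i := by
  unfold p73C; have := p73T_add_two_le_div ht hr hi₁; omega

/-- `E(T + 2c - 1) ≤ i` (the choice of `c`). [cite: BurgisserIkenmeyerPanovaJAMS2019, Prop. 7.3 (proof)] -/
theorem p73E_mul_le' (ht : 0 < t) (hr : 0 < r) (hi₁ : (r + 2 * t) ^ 2 ≤ 2 * t * i) :
    p73E t r * (p73T t r + 2 * p73C t r i - 1) ≤ i := by
  have hx := p73T_add_two_le_div ht hr hi₁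
  have hc : p73T t r + 2 * p73C t r i - 1 ≤ i / p73E t r := by unfold p73C; omega
  exact (Nat.mul_le_mul_left _ hc).trans (Nat.mul_div_le i _)

/-- `i < E(T + 2c + 1)` (maximality of `c`). [cite: BurgisserIkenmeyerPanovaJAMS2019, Prop. 7.3 (proof)] -/
theorem p73_lt_mul (ht : 0 < t) (hr : 0 < r) (hi₁ : (r + 2 * t) ^ 2 ≤ 2 * t * i) :
    i < p73E t r * (p73T t r + 2 * p73C t r i + 1) := by
  have hx := p73T_add_two_le_div ht hr hi₁
  have hc : i / p73E t r + 1 ≤ p73T t r + 2 * p73C t r i + 1 := by unfold p73C; omega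
  calc i < p73E t r * (i / p73E t r + 1) := Nat.lt_mul_div_succ i p73E_pos
    _ ≤ _ := Nat.mul_le_mul_left _ hc

/-- **The row sum of the design**: `δ + E(T + 2c - 1) = i`. [cite: BurgisserIkenmeyerPanovaJAMS2019, Prop. 7.3 (proof)] -/
theorem p73D_add (ht : 0 < t) (hr : 0 < r) (hi₁ : (r + 2 * t) ^ 2 ≤ 2 * t * i) :
    p73D t r i + p73E t r * (p73T t r + 2 * p73C t r i - 1) = i :=
  Nat.sub_add_cancel (p73E_mul_le' ht hr hi₁)

/-- **The defect is small**: `δ + 1 ≤ 2E`. [cite: BurgisserIkenmeyerPanovaJAMS2019, Prop. 7.3 (proof)] -/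
theorem p73D_lt (ht : 0 < t) (hr : 0 < r) (hi₁ : (r + 2 * t) ^ 2 ≤ 2 * t * i) :
    p73D t r i + 1 ≤ 2 * p73E t r := by
  have h1 := p73D_add ht hr hi₁
  have h2 := p73_lt_mul ht hr hi₁
  have hT : 1 ≤ p73T t r := le_trans (by omega) (two_mul_le_p73T (t := t) (r := r))
  have h3 : p73E t r * (p73T t r + 2 * p73C t r i + 1) =
      p73E t r * (p73T t r + 2 * p73C t r i - 1) + 2 * p73E t r := by
    rw [show p73T t r + 2 * p73C t r i + 1 = (p73T t r + 2 * p73C t r i - 1) + 2 by omega, Nat.mul_add]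
    ring
  omega

/-- `K ≤ T`. [cite: BurgisserIkenmeyerPanovaJAMS2019, Prop. 7.3 (proof)] -/
theorem p73K_le : p73K t r i ≤ p73T t r := by unfold p73K; split_ifs <;> omega

/-- `T - 1 ≤ K`. [cite: BurgisserIkenmeyerPanovaJAMS2019, Prop. 7.3 (proof)] -/
theorem p73T_sub_one_le_p73K : p73T t r - 1 ≤ p73K t r i := by unfold p73K; split_ifs <;> omega

/-- **Enough block labels to hang the first column**: `r ≤ K`. [cite: BurgisserIkenmeyerPanovaJAMS2019, Prop. 7.3 (proof)] -/
theorem le_p73K (ht : 0 < t) (hr : 0 < r) : r ≤ p73K t r i := by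
  have := (p73T_bounds (t := t) ht hr).1
  unfold p73K; split_ifs with h <;> omega

/-- The `t` largest labels are block labels: `t ≤ K`. [cite: BurgisserIkenmeyerPanovaJAMS2019, Prop. 7.3 (proof)] -/
theorem t_le_p73K (ht : 0 < t) : t ≤ p73K t r i := by
  have := two_mul_le_p73T (t := t) (r := r)
  have := p73T_sub_one_le_p73K (t := t) (r := r) (i := i)
  omega

/-- **Few enough block labels**: `K + i + 1 ≤ r + 2t + i` (`≤ d`). [cite: BurgisserIkenmeyerPanovaJAMS2019, Prop. 7.3 (proof)] -/
theorem p73K_add_le (ht : 0 < t) (hr : 0 < r) : p73K t r i + i + 1 ≤ r + 2 * t + i := by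
  have := (p73T_bounds (t := t) ht hr).2
  have := p73K_le (t := t) (r := r) (i := i)
  omega

/-! #### 4b. The sizes `mul u + [u < r]`: strictly decreasing, at least `2`, at most `6t + 2r + 1` -/

/-- **The sizes are strictly decreasing in the label.** [cite: BurgisserIkenmeyerPanovaJAMS2019, Prop. 7.3 (proof)] -/
theorem p73Q_succ_lt {u : ℕ} (hu : u + 1 < p73T t r) :
    p73Mul t r i (u + 1) + (if u + 1 < r then 1 else 0) < p73Mul t r i u + (if u < r then 1 else 0) := by
  unfold p73Mul
  have h1 : p73T t r - 1 - u = (p73T t r - 1 - (u + 1)) + 1 := by omega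
  rw [h1]
  split_ifs <;> (try simp only [and_false] at *) <;> omega

/-- The sizes are strictly decreasing on `[0, T)`. [cite: BurgisserIkenmeyerPanovaJAMS2019, Prop. 7.3 (proof)] -/
theorem p73Q_lt_of_lt {u v : ℕ} (huv : u < v) (hv : v < p73T t r) :
    p73Mul t r i v + (if v < r then 1 else 0) < p73Mul t r i u + (if u < r then 1 else 0) := by
  induction v with
  | zero => exact absurd huv (Nat.not_lt_zero u)
  | succ v ih =>
    rcases Nat.lt_succ_iff_lt_or_eq.mp huv with h | h
    · exact (p73Q_succ_lt hv).trans (ih h (by omega))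
    · subst h; exact p73Q_succ_lt hv

/-- **BIP Claim 7.1's hypothesis: the sizes `|C_u ∖ C_u^1|` of the block labels are pairwise
distinct.** [cite: BurgisserIkenmeyerPanovaJAMS2019, Claim 7.1 and Prop. 7.3 (proof)] -/
theorem p73Q_injOn {u v : ℕ} (hu : u < p73K t r i) (hv : v < p73K t r i)
    (h : p73Mul t r i u + (if u < r then 1 else 0) = p73Mul t r i v + (if v < r then 1 else 0)) : u = v := by
  have hK := p73K_le (t := t) (r := r) (i := i)
  rcases lt_trichotomy u v with hlt | rfl | hgt
  · have := p73Q_lt_of_lt (i := i) hlt (lt_of_lt_of_le hv hK); omega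
  · rfl
  · have := p73Q_lt_of_lt (i := i) hgt (lt_of_lt_of_le hu hK); omega

/-- **Every block label has at least two structured cells** (the correction of the printed tableau,
whose label `1` has a single cell below the first row). [cite: BurgisserIkenmeyerPanovaJAMS2019, Claim 7.1 and Prop. 7.3 (proof)] -/
theorem two_le_p73Q (ht : 0 < t) (hr : 0 < r) (hi₁ : (r + 2 * t) ^ 2 ≤ 2 * t * i) {u : ℕ}
    (hu : u < p73K t r i) : 2 ≤ p73Mul t r i u + (if u < r then 1 else 0) := by
  have hc := one_le_p73C ht hr hi₁
  unfold p73K at hu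
  unfold p73Mul
  split_ifs at hu ⊢ <;> omega

/-- The sizes are bounded by the first one, `≤ c + T + δ + 1`. [cite: BurgisserIkenmeyerPanovaJAMS2019, Prop. 7.3 (proof)] -/
theorem p73Q_le (u : ℕ) :
    p73Mul t r i u + (if u < r then 1 else 0) ≤ p73C t r i + p73T t r + p73D t r i + 1 := by
  unfold p73Mul; split_ifs <;> omega

/-- The polynomial inequality behind the size bound: for `T = 2tE`, `r + 2t = T + ρ`, `1 ≤ ρ ≤ 2t`,
`(r+2t)² + 2t(r+t+1) + T² + 4ET ≤ (12t + 4r + 1)T` (the difference is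
`8tE²(t-1) + ρ(T-ρ) + ρ(T-2t) + 2tT + (T-2t) + 2t²`). [folklore] -/
theorem p73_poly_ineq (t E ρ r T : ℕ) (ht : 1 ≤ t) (hE : 1 ≤ E) (hρ₁ : 1 ≤ ρ) (hρ₂ : ρ ≤ 2 * t)
    (hT : T = 2 * t * E) (hrT : r + 2 * t = T + ρ) :
    (r + 2 * t) ^ 2 + 2 * t * (r + t + 1) + T * T + 4 * E * T ≤ (12 * t + 4 * r + 1) * T := by
  subst hT
  have htE : t ≤ t * E := Nat.le_mul_of_pos_right _ hE
  have hρT : ρ ≤ 2 * t * E := hρ₂.trans (by rw [mul_assoc]; exact Nat.mul_le_mul_left 2 htE)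
  zify at hrT htE hρT ⊢
  have hr' : (r : ℤ) = 2 * t * E + ρ - 2 * t := by linarith
  rw [hr']
  have ha : (0 : ℤ) ≤ (t : ℤ) * (E : ℤ) ^ 2 * ((t : ℤ) - 1) := by
    apply mul_nonneg (by positivity)
    have : (1 : ℤ) ≤ t := by exact_mod_cast ht
    linarith
  have hb : (0 : ℤ) ≤ (ρ : ℤ) * (2 * t * E - ρ) := mul_nonneg (by positivity) (by linarith)
  have hc : (0 : ℤ) ≤ (ρ : ℤ) * (2 * t * E - 2 * t) := mul_nonneg (by positivity) (by linarith)
  have hd : (0 : ℤ) ≤ 2 * (t : ℤ) * E - 2 * t := by linarith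
  have he : (0 : ℤ) ≤ (t : ℤ) ^ 2 * E := by positivity
  have hf : (0 : ℤ) ≤ (t : ℤ) ^ 2 := by positivity
  nlinarith [ha, hb, hc, hd, he, hf]

/-- **The sizes fit into `n > 6t + 2r` letters**: `c + T + δ + 1 ≤ 6t + 2r + 1`. From `2c + T ≤
⌊i/E⌋ + 1`, `δ + 1 ≤ 2E`, `E⌊i/E⌋ ≤ i`, `2ti ≤ (r+2t)² + 2t(r+t+1)` and `p73_poly_ineq`.
[cite: BurgisserIkenmeyerPanovaJAMS2019, Prop. 7.3 (proof)] -/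
theorem p73_size_bound (ht : 0 < t) (hr : 0 < r) (hi₁ : (r + 2 * t) ^ 2 ≤ 2 * t * i)
    (hi₂ : 2 * t * i ≤ (r + 2 * t) ^ 2 + 2 * t * (r + t + 1)) :
    p73C t r i + p73T t r + p73D t r i + 1 ≤ 6 * t + 2 * r + 1 := by
  obtain ⟨hrT, hTr⟩ := p73T_bounds (t := t) ht hr
  have hx := p73T_add_two_le_div ht hr hi₁
  have hδ := p73D_lt ht hr hi₁
  have h2c : 2 * p73C t r i + p73T t r ≤ i / p73E t r + 1 := by unfold p73C; omega
  have hEx : p73E t r * (i / p73E t r) ≤ i := Nat.mul_div_le i _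
  set E := p73E t r with hE
  set T := p73T t r with hT
  set x := i / E with hxdef
  have hTE : T = 2 * t * E := rfl
  have hE1 : 1 ≤ E := p73E_pos
  suffices hsuff : x + T + 4 * E ≤ 12 * t + 4 * r + 1 by omega
  have hTpos : 0 < T := by omega
  refine Nat.le_of_mul_le_mul_left ?_ hTpos
  have hTx : T * x ≤ 2 * t * i := by
    rw [hTE, mul_assoc]; exact Nat.mul_le_mul_left _ hEx
  obtain ⟨ρ, hρ⟩ : ∃ ρ, r + 2 * t = T + ρ := ⟨r + 2 * t - T, by omega⟩
  have key := p73_poly_ineq t E ρ r T ht hE1 (by omega) (by omega) hTE hρ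
  calc T * (x + T + 4 * E) = T * x + T * T + 4 * E * T := by ring
    _ ≤ 2 * t * i + T * T + 4 * E * T := by omega
    _ ≤ (r + 2 * t) ^ 2 + 2 * t * (r + t + 1) + T * T + 4 * E * T := by omega
    _ ≤ (12 * t + 4 * r + 1) * T := key
    _ = T * (12 * t + 4 * r + 1) := by ring

/-! #### 4c. The row sums -/

/-- Summation over an even number of layers, pair by pair. [folklore] -/
theorem sum_range_two_mul (g : ℕ → ℕ) (a : ℕ) :
    ∑ q ∈ range (2 * a), g q = ∑ α ∈ range a, (g (2 * α) + g (2 * α + 1)) := by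
  induction a with
  | zero => simp
  | succ a ih =>
    rw [show 2 * (a + 1) = 2 * a + 1 + 1 by ring, sum_range_succ, sum_range_succ, ih, sum_range_succ,
      add_assoc]

/-- **The cells of a block row, layer by layer**: summing `f` over the slots `u < 2at` of zigzag row
`j` is summing `f (2αt + j) + f ((2α+1)t + (t-1-j))` over the pairs of layers `α < a` (BIP: "the
row `k` of `T'` contains the `e` different labels `k, 2t+1-k, 2t+k, 4t+1-k, …, t(e-2)+k, te+1-k`").
[cite: BurgisserIkenmeyerPanovaJAMS2019, Prop. 7.3 (proof)] -/
theorem sum_filter_p73Row (ht : 0 < t) (f : ℕ → ℕ) (a : ℕ) {j : ℕ} (hj : j < t) :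
    ∑ u ∈ (range (2 * a * t)).filter (fun u => p73Row t u = j), f u =
      ∑ α ∈ range a, (f (2 * α * t + j) + f ((2 * α + 1) * t + (t - 1 - j))) := by
  rw [Finset.sum_filter, sum_range_layers _ (2 * a) t]
  have hin : ∀ q, ∑ j' ∈ range t, (if p73Row t (q * t + j') = j then f (q * t + j') else 0) =
      f (q * t + (if q % 2 = 0 then j else t - 1 - j)) := by
    intro q
    set σ := (if q % 2 = 0 then j else t - 1 - j) with hσdef
    have hσ : σ < t := by rw [hσdef]; split_ifs <;> omega
    have hrowσ : ∀ j', j' < t → (p73Row t (q * t + j') = j ↔ j' = σ) := by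
      intro j' hj'
      rw [p73Row_layer ht q hj', hσdef]
      split_ifs <;> omega
    rw [Finset.sum_eq_single_of_mem σ (mem_range.mpr hσ)]
    · rw [if_pos ((hrowσ σ hσ).mpr rfl)]
    · intro j' hj' hne
      rw [if_neg (fun h => hne ((hrowσ j' (mem_range.mp hj')).mp h))]
  rw [Finset.sum_congr rfl (fun q _ => hin q), sum_range_two_mul]
  refine Finset.sum_congr rfl fun α _ => ?_
  rw [if_pos (by omega : 2 * α % 2 = 0), if_neg (by omega : ¬ (2 * α + 1) % 2 = 0)]

/-- **The zigzag balances the rows**: over `a` pairs of layers with `2at ≤ T`, the multiplicities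
`c + (T - 1 - u)` of zigzag row `j` sum to `a(2c + 2T - 1) - 2ta²`; for `a = E` (all layers, `T =
2tE`) this is `E(T + 2c - 1)`, the same for every row (BIP's "adding up to the row length of
`∑_α ((2(α-1)t + k) + (2αt + 1 - k)) = (te+1)e/2 = i`", shifted by `c - 1`).
[cite: BurgisserIkenmeyerPanovaJAMS2019, Prop. 7.3 (proof)] -/
theorem sum_pairs_base (c T : ℕ) {j : ℕ} (hj : j < t) :
    ∀ a : ℕ, 2 * a * t ≤ T →
      (∑ α ∈ range a, ((c + (T - 1 - (2 * α * t + j))) + (c + (T - 1 - ((2 * α + 1) * t + (t - 1 - j)))))) +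
        2 * t * a ^ 2 = a * (2 * c + 2 * T - 1)
  | 0, _ => by simp
  | a + 1, ha => by
    have ha' : 2 * a * t ≤ T := le_trans (by nlinarith) ha
    have ih := sum_pairs_base c T hj a ha'
    rw [sum_range_succ]
    have e1 : 2 * (a + 1) * t = 2 * a * t + 2 * t := by ring
    have e2 : (2 * a + 1) * t = 2 * a * t + t := by ring
    have e3 : 2 * t * (a + 1) ^ 2 = 2 * t * a ^ 2 + 2 * (2 * a * t) + 2 * t := by ring
    have e4 : (a + 1) * (2 * c + 2 * T - 1) = a * (2 * c + 2 * T - 1) + (2 * c + 2 * T - 1) := by ring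
    rw [e2, e3, e4]
    rw [e1] at ha
    omega

/-- The row sum of the base multiplicities `c + (T - 1 - u)` over all `T` slots of a zigzag row is
`E(T + 2c - 1)`. [cite: BurgisserIkenmeyerPanovaJAMS2019, Prop. 7.3 (proof)] -/
theorem sum_filter_base (ht : 0 < t) (c : ℕ) {j : ℕ} (hj : j < t) :
    ∑ u ∈ (range (p73T t r)).filter (fun u => p73Row t u = j), (c + (p73T t r - 1 - u)) =
      p73E t r * (p73T t r + 2 * c - 1) := by
  have hT : p73T t r = 2 * p73E t r * t := by unfold p73T; ring
  have h1 := sum_filter_p73Row ht (fun u => c + (p73T t r - 1 - u)) (p73E t r) hj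
  rw [← hT] at h1
  rw [h1]
  have h2 := sum_pairs_base (t := t) c (p73T t r) hj (p73E t r) hT.ge
  have h3 : 2 * t * p73E t r ^ 2 = p73E t r * p73T t r := by unfold p73T; ring
  have h4 : p73E t r * (p73T t r + 2 * c - 1) + p73E t r * p73T t r = p73E t r * (2 * c + 2 * p73T t r - 1) := by
    have : 1 ≤ p73T t r := le_trans (by omega) (two_mul_le_p73T (t := t) (r := r))
    rw [← Nat.mul_add]
    congr 1
    omega
  omega

/-- The last slot `T - 1` lies in zigzag row `0` (odd top layer). [cite: BurgisserIkenmeyerPanovaJAMS2019, Prop. 7.3 (proof)] -/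
theorem p73Row_sub_one (ht : 0 < t) : p73Row t (p73T t r - 1) = 0 := by
  have hT : p73T t r - 1 = (2 * (p73E t r - 1) + 1) * t + (t - 1) := by
    have hE : 1 ≤ p73E t r := p73E_pos
    unfold p73T
    zify [hE, Nat.one_le_iff_ne_zero.mpr (by positivity : 2 * t * p73E t r ≠ 0), Nat.one_le_iff_ne_zero.mpr ht.ne']
    ring
  rw [hT, p73Row_layer ht _ (by omega : t - 1 < t), if_neg (by omega)]
  omega

/-- **Every block row of the design has exactly `i` block cells.** Over the block labels `u < K` of
zigzag row `j`, the multiplicities `p73Mul` sum to `E(T + 2c - 1) + δ = i`: the base part by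
`sum_filter_base` (minus the dropped label `T - 1` of row `0`, multiplicity `c = 1`, in the dropping
case), the defect `δ` once (label `j < t`), and the dropped cell once for row `0`.
[cite: BurgisserIkenmeyerPanovaJAMS2019, Prop. 7.3 (proof)] -/
theorem p73_rowsum (ht : 0 < t) (hr : 0 < r) (hi₁ : (r + 2 * t) ^ 2 ≤ 2 * t * i) {j : ℕ} (hj : j < t) :
    ∑ u ∈ (range (p73K t r i)).filter (fun u => p73Row t u = j), p73Mul t r i u = i := by
  have hD := p73D_add ht hr hi₁
  have htK := t_le_p73K (r := r) (i := i) ht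
  have hT1 : 1 ≤ p73T t r := le_trans (by omega) (two_mul_le_p73T (t := t) (r := r))
  set K := p73K t r i with hK
  set S := (range K).filter (fun u => p73Row t u = j) with hS
  -- the defect term
  have hdef : ∑ u ∈ S, (if u < t then p73D t r i else 0) = p73D t r i := by
    rw [← Finset.sum_filter]
    have : S.filter (fun u => u < t) = {j} := by
      ext u
      simp only [hS, mem_filter, mem_range, mem_singleton]
      constructor
      · rintro ⟨⟨-, hrow⟩, hut⟩
        rw [p73Row_of_lt hut] at hrow
        exact hrow
      · rintro rfl
        exact ⟨⟨lt_of_lt_of_le hj htK, p73Row_of_lt hj⟩, hj⟩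
    rw [this, sum_singleton]
  -- membership of `0` and of `T - 1`
  have h0S : (0 : ℕ) ∈ S ↔ j = 0 := by
    simp only [hS, mem_filter, mem_range, p73Row_of_lt ht]
    constructor
    · rintro ⟨-, h⟩; exact h.symm
    · rintro rfl; exact ⟨by omega, rfl⟩
  by_cases hdrop : p73C t r i = 1 ∧ r < p73T t r
  · -- dropping case: K = T - 1
    have hKT : K = p73T t r - 1 := p73K_of_drop hdrop
    have hdrp : ∑ u ∈ S, (if p73C t r i = 1 ∧ r < p73T t r ∧ u = 0 then 1 else 0) = if j = 0 then 1 else 0 := by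
      have : ∀ u ∈ S, (if p73C t r i = 1 ∧ r < p73T t r ∧ u = 0 then 1 else 0) = if u = 0 then 1 else 0 := by
        intro u _
        by_cases hu : u = 0
        · rw [if_pos ⟨hdrop.1, hdrop.2, hu⟩, if_pos hu]
        · rw [if_neg (fun h => hu h.2.2), if_neg hu]
      rw [Finset.sum_congr rfl this, Finset.sum_ite_eq' S 0 (fun _ => 1)]
      by_cases hj0 : j = 0
      · rw [if_pos (h0S.mpr hj0), if_pos hj0]
      · rw [if_neg (fun h => hj0 (h0S.mp h)), if_neg hj0]
    have hbase : ∑ u ∈ S, (p73C t r i + (p73T t r - 1 - u)) + (if j = 0 then 1 else 0) =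
        p73E t r * (p73T t r + 2 * p73C t r i - 1) := by
      rw [← sum_filter_base (r := r) ht (p73C t r i) hj]
      have hsplit : range (p73T t r) = insert (p73T t r - 1) (range (p73T t r - 1)) := by
        conv_lhs => rw [show p73T t r = p73T t r - 1 + 1 by omega]
        exact range_add_one
      rw [hsplit, filter_insert, p73Row_sub_one ht]
      by_cases hj0 : j = 0
      · subst hj0
        rw [if_pos rfl, if_pos rfl, sum_insert (by simp), hS, hKT, hdrop.1]
        simp only [Nat.sub_self, add_zero]
        omega
      · rw [if_neg (Ne.symm hj0), if_neg hj0, hS, hKT, add_zero]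
    unfold p73Mul
    rw [sum_add_distrib, sum_add_distrib, hdef, hdrp]
    omega
  · -- non-dropping case: K = T
    have hKT : K = p73T t r := p73K_of_not_drop hdrop
    have hdrp : ∑ u ∈ S, (if p73C t r i = 1 ∧ r < p73T t r ∧ u = 0 then 1 else 0) = 0 :=
      Finset.sum_eq_zero fun u _ => if_neg fun h => hdrop ⟨h.1, h.2.1⟩
    have hbase : ∑ u ∈ S, (p73C t r i + (p73T t r - 1 - u)) = p73E t r * (p73T t r + 2 * p73C t r i - 1) := by
      rw [hS, hKT]; exact sum_filter_base ht _ hj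
    unfold p73Mul
    rw [sum_add_distrib, sum_add_distrib, hdef, hdrp, hbase]
    omega

end P73Arith

/-! ### 5. Discharge of BIP Prop. 7.3 -/

section Discharge

/-- **Discharge of `bip2019_prop_7_3` — BIP Prop. 7.3 (positivity of the plethysm coefficients of the
hook-like shapes).** "Let `t, r` be positive integers, `i ∈ [(r+2t)²/(2t), (r+2t)²/(2t) + r + t + 1]`,
and let `n > 6t + 2r` and `d > r + 2t + i`. Let `ν = (t+1) × i + (r+1) × 1 + (j)`, where `j = dn -
(r+1) - (t+1)i`. Then `a_ν(d[n]) > 0`." (weight form of the topic, as vendored in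
`OccurrenceObstructionsHooks.lean`). Proof by the method of §7 — an explicit content tableau `T` of
shape `ν` with content `d × n` whose tableau vector `v_T` pairs to a nonzero number with the row
tensor, because every respecting bijection of nonzero value preserves rows (Claim 7.1 and the
row-rigidity criterion `CplxAlg.fst_perm_eq_fst`, pipeline `exists_hwv_hookPartition_of_design`) —
applied to the block design `p73Row`/`p73Mul`/`p73K` of §3:
BIP's subtableau `T'` (zigzag rows, `e = 2(⌊(r-1)/2t⌋+1)` layers, first-column labels the `r`
largest) with the multiplicities shifted by the maximal `c ≥ 1` with `E(T+2c-1) ≤ i`, the defect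
`δ < 2E` put on the `t` largest labels, and the label of multiplicity one of the printed tableau
(for which a respecting bijection of value `-1` exists) dropped when `c = 1 < T - r + 1`. The
hypotheses of the pipeline are `p73_rowsum` (rows of length `i`), `p73Q_injOn`, `two_le_p73Q`,
`p73_size_bound` (`sizes ≤ 6t + 2r + 1 ≤ n`), `le_p73K`, `p73K_add_le` (`K + i + 1 ≤ d`); no
reduction to small `n, d` (Lemma 4.5, (5.3)) is needed, surplus labels and letters being absorbed by
singleton cells. This covers both printed cases `r < t` (Prop. 7.2) and `r ≥ t` at once.
[cite: BurgisserIkenmeyerPanovaJAMS2019, Prop. 7.3] -/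
theorem bip2019_prop_7_3_holds : bip2019_prop_7_3 := by
  intro N t r i n d _ ht hr hi₁ hi₂ hn hd hN
  have hsize := p73_size_bound ht hr hi₁ hi₂
  refine exists_hwv_hookPartition_of_design (K := p73K t r i) (row := p73Row t) (mul := p73Mul t r i) N ht hr
    (le_p73K ht hr) (fun u _ => p73Row_lt ht u) (fun u _ hu => p73Row_of_lt hu)
    (fun j hj => p73_rowsum ht hr hi₁ hj) (fun u v hu hv h => p73Q_injOn hu hv h)
    (fun u hu => two_le_p73Q ht hr hi₁ hu) (fun u _ => (p73Q_le u).trans (by omega)) ?_ ?_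
  · have := p73K_add_le (i := i) ht hr; omega
  · rw [max_comm]; exact hN

end Discharge

end Literature.Computability.Complexity
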